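/-
Copyright (c) 2026 the pub-hodgecm-mathlib formalisation cell (harness21).  Prover seat hodgecm-mathlib-K2E1-p09 (g4), Track B ∕ K2-LIT,
h413 = `stmt-HodgeConjecture-24833`, line `K2_E1_TraceFormulaBeta`, campaign RES-RANK-ONE, page «EIS-RANK-ONE», SPEC «EIS-R6» (Maass–Selberg by explicit truncation) rung R6b,
dealt by K2E1-plan (g3) 2026-09-04T04:44:42Z («EIS-R6abc» → p09).
-/
import Summits.HodgeConjecture.HodgeConjecture.Theorems.K2E1BorelCosetsDictionary       -- ★ p857409 (this seat): `B(F)\U(J_N)(F) ≃ Quotient (rightRel arithmeticBorel)`, `pseudoEisenstein = eisensteinSeriesU`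
import Summits.HodgeConjecture.HodgeConjecture.Theorems.K2E1BorelHeightWeylUnipotent    -- ★ p857424 (this seat): R6a, ★ `UnitaryGroupBorelHeightBigCell` (N = 3 rank-one big cell)
import Literature.NumberTheory.Automorphic.UnitaryGroupBorelHeightBigCellTwo            -- ★ N = 2 rank-one big cell `borelHeight_mul_borelHeight_le_one_of_not_mem_arithmeticBorel_two`
import HarnessLib

/-!
# h413 ∕ Track B «K2-LIT», page EIS-RANK-ONE, rung R6b — `K2E1TruncatedEisensteinExplicit`: for `T ≥ 1` Arthur's ★ `truncation` of the Eisenstein series is EXPLICIT,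
# `Λ^T E(f) = E(𝟙_{H ≤ T} · f) − E(𝟙_{H > T} · M f)`, and `Λ^T E(f) = E(f) − E(f)_B` on the Siegel region `{H > T}`

Cell `pub/hodgecm-mathlib`, crux H413 = `stmt-HodgeConjecture-24833`, route `HCCMUnconditional`; dealer K2E1-plan (g3), SPEC `K2/K2E1-plan/g3/SPEC-EIS-R6-MaassSelberg.K2E1-plan-g3.md` §2 R6b.
THEOREMS ONLY (no `def`, no `instance`, no `notation`, no named-fact hypothesis, no `sorry`); lane `--kind proof --supports stmt-HodgeConjecture-24833 --as helper` (count-neutral).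
`N`-GENERIC under the RANK-ONE hypothesis `hSiegel : ∀ γ ∈ G(F) ∖ B(F), ∀ g, H(γ g) · H(g) ≤ 1` (= ★ `borelHeight_mul_borelHeight_le_one_of_not_mem_arithmeticBorel` at `N = 3`, ★ `…_two` at
`N = 2`; false for `N ≥ 4`, where `Λ^T` along `B` alone is not Arthur's operator anyway); §4 discharges it at `N = 2, 3`.  HYPOTHESIS-FIRST in the constant term: `M f` is ANY function with
`E(f)_B = f + M f` on `{H > T}` (`hCT`), discharged by NAME from ★ p857392 `borelConstantTerm_eisensteinSeriesU_two ∕ _three` with `M f (g) = (ν 𝓕)⁻¹ ∫_{N(𝔸)} f(ι(J_N) v g) dν(v)`.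

* §1 GEOMETRY OF THE CUT-OFF AT `T ≥ 1`: at most ONE coset `B(F)δ` has `H(δ g) > T` (`subsingleton_setOf_lt_borelHeight_out_mul`); hence every cut-off term function
  `δ ↦ 𝟙_{H > T}(δg) ψ(δg)` is finitely supported (the honest `hfin` of the ★ p857409 junction, discharged for cut-offs), and if `g` itself is high the high coset is `B(F)`:
  `Ψ(𝟙_{H>T} ψ)(g) = ψ(g)` = `E(𝟙_{H>T} ψ)(g)` for left-`B(F)`-invariant `ψ`.
* §2 `c_B^T E(f) = 𝟙_{H>T} f + 𝟙_{H>T} M f` under `hCT`; `Ψ` is additive on finitely supported data.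
* §3 **`truncation_eisensteinSeriesU_eq`**: `1 ≤ T`, `f`, `M f` left-`B(F)`-invariant, `hCT`, `E(f)(g)` summable ⟹ `Λ^T E(f)(g) = E(𝟙_{H≤T} f)(g) − E(𝟙_{H>T} M f)(g)`; and on `{H > T}`:
  **`truncation_eisensteinSeriesU_apply_of_lt`**: `Λ^T E(f)(g) = E(f)(g) − f(g) − M f(g)` (= `E(f) − E(f)_B`; no summability needed).
* §4 the `U(J₃)` and `U(J₂)` instances.

HONEST LABEL.  Count-neutral helper; proves no printed statement; HC_CM is proved only modulo the 7 printed citations (2 remaining named inputs: hLiu418 =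
`stmt-HodgeConjecture-24832`, h413 = `stmt-HodgeConjecture-24833`) until rung 0 closes.

## References
* [Garrett2018] P. Garrett, *Modern Analysis of Automorphic Forms by Example* 1 (2018), §1.11 and §2.10–§2.11 (`Λ^T E_s = E_s − ` tail; Maass–Selberg by explicit truncation).
* [MoeglinWaldspurger1995] C. Mœglin, J.-L. Waldspurger, *Spectral decomposition and Eisenstein series* (1995), I.2.13, IV.2.
-/

set_option autoImplicit false
set_option linter.dupNamespace false  -- the mandated namespace repeats the summit's segment (`HodgeConjecture.HodgeConjecture`)

noncomputable section
open MeasureTheory NumberField IsDedekindDomain Matrix MulAction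
open Literature.NumberTheory.Automorphic Literature.NumberTheory.Automorphic.UnitaryGroup AdelicGroupData
open Summit.HodgeConjecture.HodgeConjecture.Cruxes.H413.K2E1BorelEisensteinU
open Summit.HodgeConjecture.HodgeConjecture.Cruxes.H413.K2E1BorelCosetsDictionary
open scoped MatrixGroups NNReal

namespace Summit.HodgeConjecture.HodgeConjecture.Cruxes.H413.K2E1TruncatedEisensteinExplicit

variable {F E : Type} [Field F] [NumberField F] [Field E] [NumberField E] [Algebra F E] {c : E ≃ₐ[F] E} {N : ℕ} [NeZero N]

/-! ## §1 Geometry of the cut-off `{H > T}`, `T ≥ 1`, in `F`-rank one -/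

section Geometry

/-- `H(β g) = H(g)` for `β ∈ arithmeticBorel = B(F)` (★ `borelHeight_rational_borel_mul`, product formula). [cite: Garrett2018, §2.2] -/
theorem borelHeight_arithmeticBorel_mul {β : (quasiSplit F E c N).arithmeticSubgroup} (hβ : β ∈ arithmeticBorel F E c N) (g : (quasiSplit F E c N).Adelic) :
    borelHeight ((β : (quasiSplit F E c N).Adelic) * g) = borelHeight g := by
  obtain ⟨b, hb⟩ := MonoidHom.mem_range.1 β.2
  rw [mem_arithmeticBorel_iff, ← hb] at hβ
  rw [← hb]
  exact borelHeight_rational_borel_mul b hβ g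

/-- A cut-off of a left-`B(F)`-invariant function by a HEIGHT condition is again left-`B(F)`-invariant. [cite: Garrett2018, §2.10] -/
theorem forall_arithmeticBorel_indicator {ψ : (quasiSplit F E c N).Adelic → ℂ}
    (hψ : ∀ b ∈ arithmeticBorel F E c N, ∀ x : (quasiSplit F E c N).Adelic, ψ ((b : (quasiSplit F E c N).Adelic) * x) = ψ x) (P : ℝ≥0 → Prop) :
    ∀ b ∈ arithmeticBorel F E c N, ∀ x : (quasiSplit F E c N).Adelic,
      {y : (quasiSplit F E c N).Adelic | P (borelHeight y)}.indicator ψ ((b : (quasiSplit F E c N).Adelic) * x) =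
        {y : (quasiSplit F E c N).Adelic | P (borelHeight y)}.indicator ψ x := by
  intro b hb x
  by_cases hx : P (borelHeight x)
  · have hbx : (b : (quasiSplit F E c N).Adelic) * x ∈ {y : (quasiSplit F E c N).Adelic | P (borelHeight y)} := by
      rw [Set.mem_setOf_eq, borelHeight_arithmeticBorel_mul hb]; exact hx
    rw [Set.indicator_of_mem hbx, Set.indicator_of_mem (show x ∈ {y : (quasiSplit F E c N).Adelic | P (borelHeight y)} from hx), hψ b hb x]
  · have hbx : (b : (quasiSplit F E c N).Adelic) * x ∉ {y : (quasiSplit F E c N).Adelic | P (borelHeight y)} := by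
      rw [Set.mem_setOf_eq, borelHeight_arithmeticBorel_mul hb]; exact hx
    rw [Set.indicator_of_notMem hbx, Set.indicator_of_notMem (show x ∉ {y : (quasiSplit F E c N).Adelic | P (borelHeight y)} from hx)]

/-- **AT MOST ONE COSET IS HIGH** (`F`-rank one, `T ≥ 1`): under `hSiegel`, the set of `δ ∈ B(F)\G(F)` with `H(δ g) > T` is a subsingleton — two distinct high cosets `δ₁, δ₂` would give
`γ = δ₂δ₁⁻¹ ∉ B(F)` with `H(γ δ₁g) H(δ₁g) ≤ 1 < T² `. [cite: Garrett2018, §2.3 and §2.10] -/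
theorem subsingleton_setOf_lt_borelHeight_out_mul
    (hSiegel : ∀ γ : (quasiSplit F E c N).arithmeticSubgroup, γ ∉ arithmeticBorel F E c N →
      ∀ g : (quasiSplit F E c N).Adelic, borelHeight ((γ : (quasiSplit F E c N).Adelic) * g) * borelHeight g ≤ 1)
    {T : ℝ≥0} (hT : 1 ≤ T) (g : (quasiSplit F E c N).Adelic) :
    {q : Quotient (QuotientGroup.rightRel (arithmeticBorel F E c N)) |
      T < borelHeight (((q.out : (quasiSplit F E c N).arithmeticSubgroup) : (quasiSplit F E c N).Adelic) * g)}.Subsingleton := by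
  intro q₁ h₁ q₂ h₂
  rw [Set.mem_setOf_eq] at h₁ h₂
  by_cases hmem : q₂.out * q₁.out⁻¹ ∈ arithmeticBorel F E c N
  · rw [← Quotient.out_eq q₁, ← Quotient.out_eq q₂]
    exact Quotient.sound (QuotientGroup.rightRel_apply.2 hmem)
  · exfalso
    have hle := hSiegel _ hmem (((q₁.out : (quasiSplit F E c N).arithmeticSubgroup) : (quasiSplit F E c N).Adelic) * g)
    rw [Subgroup.coe_mul, Subgroup.coe_inv, mul_assoc, inv_mul_cancel_left] at hle
    have h1' : 1 < borelHeight (((q₁.out : (quasiSplit F E c N).arithmeticSubgroup) : (quasiSplit F E c N).Adelic) * g) := hT.trans_lt h₁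
    have h2' : 1 ≤ borelHeight (((q₂.out : (quasiSplit F E c N).arithmeticSubgroup) : (quasiSplit F E c N).Adelic) * g) := (hT.trans_lt h₂).le
    exact absurd hle (not_le.2 (lt_of_lt_of_le (by rwa [one_mul]) (mul_le_mul' h2' le_rfl)))

/-- **CUT-OFF TERM FUNCTIONS ARE FINITELY SUPPORTED** (`T ≥ 1`, rank one): for ANY `ψ`, `δ ↦ (𝟙_{H>T} ψ)(δ g)` has finite (indeed subsingleton) support on `B(F)\G(F)` — the honest `hfin` of ★
p857409 `pseudoEisenstein_eq_eisensteinSeriesU'`, discharged for cut-offs. [cite: Garrett2018, §2.10] -/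
theorem finite_support_indicator_out_mul
    (hSiegel : ∀ γ : (quasiSplit F E c N).arithmeticSubgroup, γ ∉ arithmeticBorel F E c N →
      ∀ g : (quasiSplit F E c N).Adelic, borelHeight ((γ : (quasiSplit F E c N).Adelic) * g) * borelHeight g ≤ 1)
    {T : ℝ≥0} (hT : 1 ≤ T) (ψ : (quasiSplit F E c N).Adelic → ℂ) (g : (quasiSplit F E c N).Adelic) :
    (Function.support fun q : Quotient (QuotientGroup.rightRel (arithmeticBorel F E c N)) =>
      {y : (quasiSplit F E c N).Adelic | T < borelHeight y}.indicator ψ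
        (((q.out : (quasiSplit F E c N).arithmeticSubgroup) : (quasiSplit F E c N).Adelic) * g)).Finite := by
  refine ((subsingleton_setOf_lt_borelHeight_out_mul hSiegel hT g).anti fun q hq => ?_).finite
  rw [Function.mem_support] at hq
  by_contra h
  exact hq (Set.indicator_of_notMem (s := {y : (quasiSplit F E c N).Adelic | T < borelHeight y}) h ψ)

/-- **IF `g` IS HIGH, THE HIGH COSET IS `B(F)` ITSELF**: `T ≥ 1`, `H(g) > T`, `H(δ g) > T` ⟹ `B(F)δ = B(F)`. [cite: Garrett2018, §2.3 and §2.10] -/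
theorem eq_mk_one_of_lt_borelHeight
    (hSiegel : ∀ γ : (quasiSplit F E c N).arithmeticSubgroup, γ ∉ arithmeticBorel F E c N →
      ∀ g : (quasiSplit F E c N).Adelic, borelHeight ((γ : (quasiSplit F E c N).Adelic) * g) * borelHeight g ≤ 1)
    {T : ℝ≥0} (hT : 1 ≤ T) {g : (quasiSplit F E c N).Adelic} (hg : T < borelHeight g)
    {q : Quotient (QuotientGroup.rightRel (arithmeticBorel F E c N))}
    (hq : T < borelHeight (((q.out : (quasiSplit F E c N).arithmeticSubgroup) : (quasiSplit F E c N).Adelic) * g)) :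
    q = Quotient.mk (QuotientGroup.rightRel (arithmeticBorel F E c N)) 1 := by
  refine subsingleton_setOf_lt_borelHeight_out_mul hSiegel hT g hq ?_
  -- the representative of `B(F)·1` lies in `B(F)`, where the height is that of `g`
  have hrel : (1 : (quasiSplit F E c N).arithmeticSubgroup) * ((Quotient.mk (QuotientGroup.rightRel (arithmeticBorel F E c N)) 1).out)⁻¹ ∈
      arithmeticBorel F E c N :=
    QuotientGroup.rightRel_apply.1 (Quotient.mk_out (s := QuotientGroup.rightRel (arithmeticBorel F E c N)) 1)
  rw [one_mul, inv_mem_iff] at hrel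
  rw [Set.mem_setOf_eq, borelHeight_arithmeticBorel_mul hrel]
  exact hg

/-- **`Ψ(𝟙_{H>T} ψ)(g) = ψ(g)` FOR HIGH `g`** (`T ≥ 1`, `H(g) > T`, `ψ` left-`B(F)`-invariant): the single surviving term is the `B(F)`-coset. [cite: Garrett2018, §2.10] -/
theorem pseudoEisenstein_indicator_apply_of_lt
    (hSiegel : ∀ γ : (quasiSplit F E c N).arithmeticSubgroup, γ ∉ arithmeticBorel F E c N →
      ∀ g : (quasiSplit F E c N).Adelic, borelHeight ((γ : (quasiSplit F E c N).Adelic) * g) * borelHeight g ≤ 1)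
    {T : ℝ≥0} (hT : 1 ≤ T) {ψ : (quasiSplit F E c N).Adelic → ℂ}
    (hψ : ∀ b ∈ arithmeticBorel F E c N, ∀ x : (quasiSplit F E c N).Adelic, ψ ((b : (quasiSplit F E c N).Adelic) * x) = ψ x)
    {g : (quasiSplit F E c N).Adelic} (hg : T < borelHeight g) :
    pseudoEisenstein ({y : (quasiSplit F E c N).Adelic | T < borelHeight y}.indicator ψ) g = ψ g := by
  rw [pseudoEisenstein_def, finsum_eq_single _ (Quotient.mk (QuotientGroup.rightRel (arithmeticBorel F E c N)) 1) (fun q hq =>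
    Set.indicator_of_notMem (s := {y : (quasiSplit F E c N).Adelic | T < borelHeight y}) (fun h => hq (eq_mk_one_of_lt_borelHeight hSiegel hT hg h)) ψ),
    pseudoEisenstein_term_eq (forall_arithmeticBorel_indicator hψ fun h => T < h) 1 g, OneMemClass.coe_one, one_mul]
  exact Set.indicator_of_mem (s := {y : (quasiSplit F E c N).Adelic | T < borelHeight y}) hg ψ

/-- The same for p08's `tsum`: **`E(𝟙_{H>T} ψ)(g) = ψ(g)`** for high `g` (through ★ p857409 `pseudoEisenstein_eq_eisensteinSeriesU'`, finiteness by §1). [cite: Garrett2018, §2.10] -/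
theorem eisensteinSeriesU_indicator_apply_of_lt
    (hSiegel : ∀ γ : (quasiSplit F E c N).arithmeticSubgroup, γ ∉ arithmeticBorel F E c N →
      ∀ g : (quasiSplit F E c N).Adelic, borelHeight ((γ : (quasiSplit F E c N).Adelic) * g) * borelHeight g ≤ 1)
    {T : ℝ≥0} (hT : 1 ≤ T) {ψ : (quasiSplit F E c N).Adelic → ℂ}
    (hψ : ∀ b ∈ arithmeticBorel F E c N, ∀ x : (quasiSplit F E c N).Adelic, ψ ((b : (quasiSplit F E c N).Adelic) * x) = ψ x)
    {g : (quasiSplit F E c N).Adelic} (hg : T < borelHeight g) :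
    eisensteinSeriesU ({y : (quasiSplit F E c N).Adelic | T < borelHeight y}.indicator ψ) g = ψ g := by
  rw [← pseudoEisenstein_eq_eisensteinSeriesU' (forall_arithmeticBorel_indicator hψ fun h => T < h) g (finite_support_indicator_out_mul hSiegel hT ψ g)]
  exact pseudoEisenstein_indicator_apply_of_lt hSiegel hT hψ hg

end Geometry

/-! ## §2 The tail of the constant term of `E(f)` under `hCT`, and additivity of `Ψ` on finitely supported data -/

section Tail

variable [MeasurableSpace (adelicUnipotent F E c N)]

/-- **`c_B^T E(f) = 𝟙_{H>T}·f + 𝟙_{H>T}·M f`** whenever `E(f)_B = f + M f` on `{H > T}` (`hCT`, hypothesis-first; `M f` is any function). [cite: Garrett2018, §2.10–§2.11] -/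
theorem constantTermTail_eisensteinSeriesU_eq {ν : Measure (adelicUnipotent F E c N)} {𝓕 : Set (adelicUnipotent F E c N)} {T : ℝ≥0}
    {f Mf : (quasiSplit F E c N).Adelic → ℂ}
    (hCT : ∀ x : (quasiSplit F E c N).Adelic, T < borelHeight x → borelConstantTerm ν 𝓕 (eisensteinSeriesU f) x = f x + Mf x) :
    constantTermTail ν 𝓕 T (eisensteinSeriesU f) =
      {y : (quasiSplit F E c N).Adelic | T < borelHeight y}.indicator f + {y : (quasiSplit F E c N).Adelic | T < borelHeight y}.indicator Mf := by
  funext x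
  by_cases hx : T < borelHeight x
  · rw [constantTermTail_of_lt _ hx, hCT x hx, Pi.add_apply, Set.indicator_of_mem (s := {y : (quasiSplit F E c N).Adelic | T < borelHeight y}) hx,
      Set.indicator_of_mem (s := {y : (quasiSplit F E c N).Adelic | T < borelHeight y}) hx]
  · rw [constantTermTail_of_not_lt _ hx, Pi.add_apply, Set.indicator_of_notMem (s := {y : (quasiSplit F E c N).Adelic | T < borelHeight y}) hx,
      Set.indicator_of_notMem (s := {y : (quasiSplit F E c N).Adelic | T < borelHeight y}) hx, add_zero]

omit [NeZero N] [MeasurableSpace (adelicUnipotent F E c N)] in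
/-- `Ψ` is additive on term functions with finite support (Mathlib `finsum_add_distrib`; without finiteness the `finsum` junk value breaks additivity). [cite: Garrett2018, §2.10] -/
theorem pseudoEisenstein_add_of_finite {φ ψ : (quasiSplit F E c N).Adelic → ℂ} {g : (quasiSplit F E c N).Adelic}
    (hφ : (Function.support fun q : Quotient (QuotientGroup.rightRel (arithmeticBorel F E c N)) =>
      φ (((q.out : (quasiSplit F E c N).arithmeticSubgroup) : (quasiSplit F E c N).Adelic) * g)).Finite)
    (hψ : (Function.support fun q : Quotient (QuotientGroup.rightRel (arithmeticBorel F E c N)) =>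
      ψ (((q.out : (quasiSplit F E c N).arithmeticSubgroup) : (quasiSplit F E c N).Adelic) * g)).Finite) :
    pseudoEisenstein (φ + ψ) g = pseudoEisenstein φ g + pseudoEisenstein ψ g := by
  rw [pseudoEisenstein_def, pseudoEisenstein_def, pseudoEisenstein_def]
  simp only [Pi.add_apply]
  exact finsum_add_distrib hφ hψ

end Tail

/-! ## §3 The explicit truncation of `E(f)` for `T ≥ 1` -/

section Explicit

variable [MeasurableSpace (adelicUnipotent F E c N)]

omit [NeZero N] [MeasurableSpace (adelicUnipotent F E c N)] in
/-- Summability of the Eisenstein terms transfers from p08's index to Track A's (★ p857409 dictionary + `Equiv.summable_iff`). [cite: MoeglinWaldspurger1995, II.1.5] -/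
theorem summable_arithmeticBorelQuot_of_summable {f : (quasiSplit F E c N).Adelic → ℂ}
    (hf : ∀ b ∈ arithmeticBorel F E c N, ∀ x : (quasiSplit F E c N).Adelic, f ((b : (quasiSplit F E c N).Adelic) * x) = f x)
    {g : (quasiSplit F E c N).Adelic}
    (hsum : Summable fun q : Quotient (orbitRel ↥(borelU (c : E →+* E) ((StdForm.antidiagonal N).over E)) ↥(unitaryGroupOfForm (c : E →+* E) ((StdForm.antidiagonal N).over E))) =>
      f ((quasiSplit F E c N).toAdelic (q.out : ↥(unitaryGroupOfForm (c : E →+* E) ((StdForm.antidiagonal N).over E))) * g)) :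
    Summable fun q : Quotient (QuotientGroup.rightRel (arithmeticBorel F E c N)) =>
      f (((q.out : (quasiSplit F E c N).arithmeticSubgroup) : (quasiSplit F E c N).Adelic) * g) := by
  obtain ⟨κ, hκ⟩ := exists_equiv_arithmeticBorelQuot (F := F) (E := E) (c := c) (N := N)
  have h : (fun q : Quotient (orbitRel ↥(borelU (c : E →+* E) ((StdForm.antidiagonal N).over E)) ↥(unitaryGroupOfForm (c : E →+* E) ((StdForm.antidiagonal N).over E))) =>
      f ((quasiSplit F E c N).toAdelic (q.out : ↥(unitaryGroupOfForm (c : E →+* E) ((StdForm.antidiagonal N).over E))) * g)) =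
      (fun q : Quotient (QuotientGroup.rightRel (arithmeticBorel F E c N)) =>
        f (((q.out : (quasiSplit F E c N).arithmeticSubgroup) : (quasiSplit F E c N).Adelic) * g)) ∘ κ :=
    funext fun q => (apply_out_eq hf κ hκ q g).symm
  rw [h] at hsum
  exact (Equiv.summable_iff κ).1 hsum

omit [NeZero N] [MeasurableSpace (adelicUnipotent F E c N)] in
/-- The height split `f = 𝟙_{H≤T} f + 𝟙_{H>T} f`, pointwise. [cite: Garrett2018, §2.11] -/
theorem indicator_le_add_indicator_lt [NeZero N] (T : ℝ≥0) (f : (quasiSplit F E c N).Adelic → ℂ) (y : (quasiSplit F E c N).Adelic) :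
    {y : (quasiSplit F E c N).Adelic | borelHeight y ≤ T}.indicator f y + {y : (quasiSplit F E c N).Adelic | T < borelHeight y}.indicator f y = f y := by
  have h : {y : (quasiSplit F E c N).Adelic | T < borelHeight y} = {y : (quasiSplit F E c N).Adelic | borelHeight y ≤ T}ᶜ := by
    ext z; simp only [Set.mem_setOf_eq, Set.mem_compl_iff, not_le]
  rw [h, ← Pi.add_apply ({y : (quasiSplit F E c N).Adelic | borelHeight y ≤ T}.indicator f), Set.indicator_self_add_compl]

/-- **THE EXPLICIT TRUNCATION OF AN EISENSTEIN SERIES** (`F`-rank one, `T ≥ 1`): if `f` and `M f` are left-`B(F)`-invariant, `E(f)_B = f + M f` on `{H > T}` (`hCT`) and `E(f)(g)`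
converges, then `Λ^T E(f)(g) = E(𝟙_{H≤T}·f)(g) − E(𝟙_{H>T}·M f)(g)` — `Λ^T E(f) = E(f) − Ψ(c_B^T E(f)) = E(f) − Ψ(𝟙_{>T} f) − Ψ(𝟙_{>T} M f)`, the two `Ψ` being one-term sums equal to
the corresponding `E` (§1), and `E(f) − E(𝟙_{>T} f) = E(𝟙_{≤T} f)`. [cite: Garrett2018, §1.11 and §2.11] [cite: MoeglinWaldspurger1995, IV.2] -/
theorem truncation_eisensteinSeriesU_eq
    (hSiegel : ∀ γ : (quasiSplit F E c N).arithmeticSubgroup, γ ∉ arithmeticBorel F E c N →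
      ∀ g : (quasiSplit F E c N).Adelic, borelHeight ((γ : (quasiSplit F E c N).Adelic) * g) * borelHeight g ≤ 1)
    {ν : Measure (adelicUnipotent F E c N)} {𝓕 : Set (adelicUnipotent F E c N)} {T : ℝ≥0} (hT : 1 ≤ T)
    {f Mf : (quasiSplit F E c N).Adelic → ℂ}
    (hf : ∀ b ∈ arithmeticBorel F E c N, ∀ x : (quasiSplit F E c N).Adelic, f ((b : (quasiSplit F E c N).Adelic) * x) = f x)
    (hMf : ∀ b ∈ arithmeticBorel F E c N, ∀ x : (quasiSplit F E c N).Adelic, Mf ((b : (quasiSplit F E c N).Adelic) * x) = Mf x)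
    (hCT : ∀ x : (quasiSplit F E c N).Adelic, T < borelHeight x → borelConstantTerm ν 𝓕 (eisensteinSeriesU f) x = f x + Mf x)
    {g : (quasiSplit F E c N).Adelic}
    (hsum : Summable fun q : Quotient (orbitRel ↥(borelU (c : E →+* E) ((StdForm.antidiagonal N).over E)) ↥(unitaryGroupOfForm (c : E →+* E) ((StdForm.antidiagonal N).over E))) =>
      f ((quasiSplit F E c N).toAdelic (q.out : ↥(unitaryGroupOfForm (c : E →+* E) ((StdForm.antidiagonal N).over E))) * g)) :
    truncation ν 𝓕 T (eisensteinSeriesU f) g =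
      eisensteinSeriesU ({y : (quasiSplit F E c N).Adelic | borelHeight y ≤ T}.indicator f) g -
        eisensteinSeriesU ({y : (quasiSplit F E c N).Adelic | T < borelHeight y}.indicator Mf) g := by
  have hfI := forall_arithmeticBorel_indicator hf fun h => T < h
  have hfI' := forall_arithmeticBorel_indicator hf fun h => h ≤ T
  have hMI := forall_arithmeticBorel_indicator hMf fun h => T < h
  have hfin_f := finite_support_indicator_out_mul hSiegel hT f g
  have hfin_M := finite_support_indicator_out_mul hSiegel hT Mf g
  -- the height split of `E(f)(g)` in Track A's index
  have hsumA := summable_arithmeticBorelQuot_of_summable hf hsum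
  have hsum_gt : Summable fun q : Quotient (QuotientGroup.rightRel (arithmeticBorel F E c N)) =>
      {y : (quasiSplit F E c N).Adelic | T < borelHeight y}.indicator f (((q.out : (quasiSplit F E c N).arithmeticSubgroup) : (quasiSplit F E c N).Adelic) * g) :=
    summable_of_hasFiniteSupport hfin_f
  have hsum_le : Summable fun q : Quotient (QuotientGroup.rightRel (arithmeticBorel F E c N)) =>
      {y : (quasiSplit F E c N).Adelic | borelHeight y ≤ T}.indicator f (((q.out : (quasiSplit F E c N).arithmeticSubgroup) : (quasiSplit F E c N).Adelic) * g) := by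
    have h : (fun q : Quotient (QuotientGroup.rightRel (arithmeticBorel F E c N)) =>
        {y : (quasiSplit F E c N).Adelic | borelHeight y ≤ T}.indicator f (((q.out : (quasiSplit F E c N).arithmeticSubgroup) : (quasiSplit F E c N).Adelic) * g)) =
        {q : Quotient (QuotientGroup.rightRel (arithmeticBorel F E c N)) |
          borelHeight (((q.out : (quasiSplit F E c N).arithmeticSubgroup) : (quasiSplit F E c N).Adelic) * g) ≤ T}.indicator
          fun q => f (((q.out : (quasiSplit F E c N).arithmeticSubgroup) : (quasiSplit F E c N).Adelic) * g) := by
      funext q; simp only [Set.indicator_apply, Set.mem_setOf_eq]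
    rw [h]; exact hsumA.indicator _
  have hsplit : eisensteinSeriesU f g = eisensteinSeriesU ({y : (quasiSplit F E c N).Adelic | borelHeight y ≤ T}.indicator f) g +
      eisensteinSeriesU ({y : (quasiSplit F E c N).Adelic | T < borelHeight y}.indicator f) g := by
    rw [eisensteinSeriesU_eq_tsum_arithmeticBorelQuot hf g, eisensteinSeriesU_eq_tsum_arithmeticBorelQuot hfI' g, eisensteinSeriesU_eq_tsum_arithmeticBorelQuot hfI g,
      ← hsum_le.tsum_add hsum_gt]
    exact tsum_congr fun q => (indicator_le_add_indicator_lt T f _).symm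
  rw [truncation_def, constantTermTail_eisensteinSeriesU_eq hCT, pseudoEisenstein_add_of_finite hfin_f hfin_M, pseudoEisenstein_eq_eisensteinSeriesU' hfI g hfin_f,
    pseudoEisenstein_eq_eisensteinSeriesU' hMI g hfin_M, hsplit]
  ring

/-- **ON THE SIEGEL REGION `{H > T}`: `Λ^T E(f)(g) = E(f)(g) − f(g) − M f(g)`** (= `E(f)(g) − E(f)_B(g)`), `T ≥ 1`; no summability needed — both cut-off sums are the single `B(F)`-term (§1).
[cite: Garrett2018, §1.11 and §2.11] [cite: MoeglinWaldspurger1995, I.2.13] -/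
theorem truncation_eisensteinSeriesU_apply_of_lt
    (hSiegel : ∀ γ : (quasiSplit F E c N).arithmeticSubgroup, γ ∉ arithmeticBorel F E c N →
      ∀ g : (quasiSplit F E c N).Adelic, borelHeight ((γ : (quasiSplit F E c N).Adelic) * g) * borelHeight g ≤ 1)
    {ν : Measure (adelicUnipotent F E c N)} {𝓕 : Set (adelicUnipotent F E c N)} {T : ℝ≥0} (hT : 1 ≤ T)
    {f Mf : (quasiSplit F E c N).Adelic → ℂ}
    (hf : ∀ b ∈ arithmeticBorel F E c N, ∀ x : (quasiSplit F E c N).Adelic, f ((b : (quasiSplit F E c N).Adelic) * x) = f x)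
    (hMf : ∀ b ∈ arithmeticBorel F E c N, ∀ x : (quasiSplit F E c N).Adelic, Mf ((b : (quasiSplit F E c N).Adelic) * x) = Mf x)
    (hCT : ∀ x : (quasiSplit F E c N).Adelic, T < borelHeight x → borelConstantTerm ν 𝓕 (eisensteinSeriesU f) x = f x + Mf x)
    {g : (quasiSplit F E c N).Adelic} (hg : T < borelHeight g) :
    truncation ν 𝓕 T (eisensteinSeriesU f) g = eisensteinSeriesU f g - f g - Mf g := by
  rw [truncation_def, constantTermTail_eisensteinSeriesU_eq hCT,
    pseudoEisenstein_add_of_finite (finite_support_indicator_out_mul hSiegel hT f g) (finite_support_indicator_out_mul hSiegel hT Mf g),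
    pseudoEisenstein_indicator_apply_of_lt hSiegel hT hf hg, pseudoEisenstein_indicator_apply_of_lt hSiegel hT hMf hg]
  ring

/-- Equivalently on `{H > T}`: **`Λ^T E(f) = E(f) − E(f)_B`**. [cite: MoeglinWaldspurger1995, I.2.13] -/
theorem truncation_eisensteinSeriesU_eq_sub_borelConstantTerm_of_lt
    (hSiegel : ∀ γ : (quasiSplit F E c N).arithmeticSubgroup, γ ∉ arithmeticBorel F E c N →
      ∀ g : (quasiSplit F E c N).Adelic, borelHeight ((γ : (quasiSplit F E c N).Adelic) * g) * borelHeight g ≤ 1)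
    {ν : Measure (adelicUnipotent F E c N)} {𝓕 : Set (adelicUnipotent F E c N)} {T : ℝ≥0} (hT : 1 ≤ T)
    {f Mf : (quasiSplit F E c N).Adelic → ℂ}
    (hf : ∀ b ∈ arithmeticBorel F E c N, ∀ x : (quasiSplit F E c N).Adelic, f ((b : (quasiSplit F E c N).Adelic) * x) = f x)
    (hMf : ∀ b ∈ arithmeticBorel F E c N, ∀ x : (quasiSplit F E c N).Adelic, Mf ((b : (quasiSplit F E c N).Adelic) * x) = Mf x)
    (hCT : ∀ x : (quasiSplit F E c N).Adelic, T < borelHeight x → borelConstantTerm ν 𝓕 (eisensteinSeriesU f) x = f x + Mf x)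
    {g : (quasiSplit F E c N).Adelic} (hg : T < borelHeight g) :
    truncation ν 𝓕 T (eisensteinSeriesU f) g = eisensteinSeriesU f g - borelConstantTerm ν 𝓕 (eisensteinSeriesU f) g := by
  rw [truncation_eisensteinSeriesU_apply_of_lt hSiegel hT hf hMf hCT hg, hCT g hg]
  ring

end Explicit

/-! ## §4 The rank-one instances `U(J₃)`, `U(J₂)` -/

section Instances

/-- `hSiegel` at `N = 3` is ★ `borelHeight_mul_borelHeight_le_one_of_not_mem_arithmeticBorel`. [cite: Garrett2018, §2.3] -/
theorem siegel_three {F E : Type} [Field F] [NumberField F] [Field E] [NumberField E] [Algebra F E] {c : E ≃ₐ[F] E} :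
    ∀ γ : (quasiSplit F E c 3).arithmeticSubgroup, γ ∉ arithmeticBorel F E c 3 →
      ∀ g : (quasiSplit F E c 3).Adelic, borelHeight ((γ : (quasiSplit F E c 3).Adelic) * g) * borelHeight g ≤ 1 :=
  fun _ hγ g => borelHeight_mul_borelHeight_le_one_of_not_mem_arithmeticBorel hγ g

/-- `hSiegel` at `N = 2` is ★ `borelHeight_mul_borelHeight_le_one_of_not_mem_arithmeticBorel_two`. [cite: Garrett2018, §2.3] -/
theorem siegel_two {F E : Type} [Field F] [NumberField F] [Field E] [NumberField E] [Algebra F E] {c : E ≃ₐ[F] E} :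
    ∀ γ : (quasiSplit F E c 2).arithmeticSubgroup, γ ∉ arithmeticBorel F E c 2 →
      ∀ g : (quasiSplit F E c 2).Adelic, borelHeight ((γ : (quasiSplit F E c 2).Adelic) * g) * borelHeight g ≤ 1 :=
  fun _ hγ g => borelHeight_mul_borelHeight_le_one_of_not_mem_arithmeticBorel_two hγ g

/-- **`Λ^T E(f) = E(𝟙_{H≤T} f) − E(𝟙_{H>T} M f)` on `U(J₃)`**, `T ≥ 1`. [cite: Garrett2018, §1.11 and §2.11] -/
theorem truncation_eisensteinSeriesU_eq_three {F E : Type} [Field F] [NumberField F] [Field E] [NumberField E] [Algebra F E] {c : E ≃ₐ[F] E}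
    [MeasurableSpace (adelicUnipotent F E c 3)] {ν : Measure (adelicUnipotent F E c 3)} {𝓕 : Set (adelicUnipotent F E c 3)} {T : ℝ≥0} (hT : 1 ≤ T)
    {f Mf : (quasiSplit F E c 3).Adelic → ℂ}
    (hf : ∀ b ∈ arithmeticBorel F E c 3, ∀ x : (quasiSplit F E c 3).Adelic, f ((b : (quasiSplit F E c 3).Adelic) * x) = f x)
    (hMf : ∀ b ∈ arithmeticBorel F E c 3, ∀ x : (quasiSplit F E c 3).Adelic, Mf ((b : (quasiSplit F E c 3).Adelic) * x) = Mf x)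
    (hCT : ∀ x : (quasiSplit F E c 3).Adelic, T < borelHeight x → borelConstantTerm ν 𝓕 (eisensteinSeriesU f) x = f x + Mf x)
    {g : (quasiSplit F E c 3).Adelic}
    (hsum : Summable fun q : Quotient (orbitRel ↥(borelU (c : E →+* E) ((StdForm.antidiagonal 3).over E)) ↥(unitaryGroupOfForm (c : E →+* E) ((StdForm.antidiagonal 3).over E))) =>
      f ((quasiSplit F E c 3).toAdelic (q.out : ↥(unitaryGroupOfForm (c : E →+* E) ((StdForm.antidiagonal 3).over E))) * g)) :
    truncation ν 𝓕 T (eisensteinSeriesU f) g =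
      eisensteinSeriesU ({y : (quasiSplit F E c 3).Adelic | borelHeight y ≤ T}.indicator f) g -
        eisensteinSeriesU ({y : (quasiSplit F E c 3).Adelic | T < borelHeight y}.indicator Mf) g :=
  truncation_eisensteinSeriesU_eq siegel_three hT hf hMf hCT hsum

/-- **`Λ^T E(f) = E(𝟙_{H≤T} f) − E(𝟙_{H>T} M f)` on `U(J₂)`**, `T ≥ 1`. [cite: Garrett2018, §1.11 and §2.11] -/
theorem truncation_eisensteinSeriesU_eq_two {F E : Type} [Field F] [NumberField F] [Field E] [NumberField E] [Algebra F E] {c : E ≃ₐ[F] E}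
    [MeasurableSpace (adelicUnipotent F E c 2)] {ν : Measure (adelicUnipotent F E c 2)} {𝓕 : Set (adelicUnipotent F E c 2)} {T : ℝ≥0} (hT : 1 ≤ T)
    {f Mf : (quasiSplit F E c 2).Adelic → ℂ}
    (hf : ∀ b ∈ arithmeticBorel F E c 2, ∀ x : (quasiSplit F E c 2).Adelic, f ((b : (quasiSplit F E c 2).Adelic) * x) = f x)
    (hMf : ∀ b ∈ arithmeticBorel F E c 2, ∀ x : (quasiSplit F E c 2).Adelic, Mf ((b : (quasiSplit F E c 2).Adelic) * x) = Mf x)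
    (hCT : ∀ x : (quasiSplit F E c 2).Adelic, T < borelHeight x → borelConstantTerm ν 𝓕 (eisensteinSeriesU f) x = f x + Mf x)
    {g : (quasiSplit F E c 2).Adelic}
    (hsum : Summable fun q : Quotient (orbitRel ↥(borelU (c : E →+* E) ((StdForm.antidiagonal 2).over E)) ↥(unitaryGroupOfForm (c : E →+* E) ((StdForm.antidiagonal 2).over E))) =>
      f ((quasiSplit F E c 2).toAdelic (q.out : ↥(unitaryGroupOfForm (c : E →+* E) ((StdForm.antidiagonal 2).over E))) * g)) :
    truncation ν 𝓕 T (eisensteinSeriesU f) g =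
      eisensteinSeriesU ({y : (quasiSplit F E c 2).Adelic | borelHeight y ≤ T}.indicator f) g -
        eisensteinSeriesU ({y : (quasiSplit F E c 2).Adelic | T < borelHeight y}.indicator Mf) g :=
  truncation_eisensteinSeriesU_eq siegel_two hT hf hMf hCT hsum

/-- On `U(J₃)`, `{H > T}`, `T ≥ 1`: `Λ^T E(f)(g) = E(f)(g) − f(g) − M f(g)`. [cite: MoeglinWaldspurger1995, I.2.13] -/
theorem truncation_eisensteinSeriesU_apply_of_lt_three {F E : Type} [Field F] [NumberField F] [Field E] [NumberField E] [Algebra F E] {c : E ≃ₐ[F] E}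
    [MeasurableSpace (adelicUnipotent F E c 3)] {ν : Measure (adelicUnipotent F E c 3)} {𝓕 : Set (adelicUnipotent F E c 3)} {T : ℝ≥0} (hT : 1 ≤ T)
    {f Mf : (quasiSplit F E c 3).Adelic → ℂ}
    (hf : ∀ b ∈ arithmeticBorel F E c 3, ∀ x : (quasiSplit F E c 3).Adelic, f ((b : (quasiSplit F E c 3).Adelic) * x) = f x)
    (hMf : ∀ b ∈ arithmeticBorel F E c 3, ∀ x : (quasiSplit F E c 3).Adelic, Mf ((b : (quasiSplit F E c 3).Adelic) * x) = Mf x)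
    (hCT : ∀ x : (quasiSplit F E c 3).Adelic, T < borelHeight x → borelConstantTerm ν 𝓕 (eisensteinSeriesU f) x = f x + Mf x)
    {g : (quasiSplit F E c 3).Adelic} (hg : T < borelHeight g) :
    truncation ν 𝓕 T (eisensteinSeriesU f) g = eisensteinSeriesU f g - f g - Mf g :=
  truncation_eisensteinSeriesU_apply_of_lt siegel_three hT hf hMf hCT hg

/-- On `U(J₂)`, `{H > T}`, `T ≥ 1`: `Λ^T E(f)(g) = E(f)(g) − f(g) − M f(g)`. [cite: MoeglinWaldspurger1995, I.2.13] -/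
theorem truncation_eisensteinSeriesU_apply_of_lt_two {F E : Type} [Field F] [NumberField F] [Field E] [NumberField E] [Algebra F E] {c : E ≃ₐ[F] E}
    [MeasurableSpace (adelicUnipotent F E c 2)] {ν : Measure (adelicUnipotent F E c 2)} {𝓕 : Set (adelicUnipotent F E c 2)} {T : ℝ≥0} (hT : 1 ≤ T)
    {f Mf : (quasiSplit F E c 2).Adelic → ℂ}
    (hf : ∀ b ∈ arithmeticBorel F E c 2, ∀ x : (quasiSplit F E c 2).Adelic, f ((b : (quasiSplit F E c 2).Adelic) * x) = f x)
    (hMf : ∀ b ∈ arithmeticBorel F E c 2, ∀ x : (quasiSplit F E c 2).Adelic, Mf ((b : (quasiSplit F E c 2).Adelic) * x) = Mf x)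
    (hCT : ∀ x : (quasiSplit F E c 2).Adelic, T < borelHeight x → borelConstantTerm ν 𝓕 (eisensteinSeriesU f) x = f x + Mf x)
    {g : (quasiSplit F E c 2).Adelic} (hg : T < borelHeight g) :
    truncation ν 𝓕 T (eisensteinSeriesU f) g = eisensteinSeriesU f g - f g - Mf g :=
  truncation_eisensteinSeriesU_apply_of_lt siegel_two hT hf hMf hCT hg

end Instances

end Summit.HodgeConjecture.HodgeConjecture.Cruxes.H413.K2E1TruncatedEisensteinExplicit

end
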